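import Literature.Geometry.Lorentzian.KerrSurfaceGravity

/-!
# The conservation-law budgets pin the final Kerr parameters (first-law steepness arithmetic)

Support file of the line `area-excess-ratchet` for the crux `NearExtremalKappaCapture`
(stmt-FinalStateConjecture-10606, route `PhaseMixingCapture`), lead prover-line-stmt-FinalStateConjecture-10606-c1-0.
Pure real arithmetic over the Kerr horizon radius `Kerr.rPlus M a = M + √(M² − a²)`
(normalised Kerr horizon area `A/8π = M r₊(M, a)`), kernel-checked, no named fact used:

* `mass_drop_le_of_budgets` — FIRST-LAW STEEPNESS (the ratchet's teeth): if the final parameters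
  `(M', a')`, `0 < M' ≤ M`, `|a'| ≤ M'`, have normalised horizon area at least `M r₊(M,a) − ε_β` and
  angular momentum `|a'M' − aM| ≤ ε_γ`, then `(M − M') M² ≤ 2M ε_γ + 2√(M² − a²) ε_β`: the Kerr area
  is steep in the mass at fixed angular momentum near extremality
  (`∂(A/8π)/∂M|_J = 2Mr₊/√(M² − a²)`), so an area deficit of size `M² (1 − a²/M²)^{-1/2}·d` costs
  only `O(M d)` of mass, uniformly in the surface gravity.
* `modulus_of_budgets` — THE LAWS PIN THE PARAMETERS: mass loss `M' ≤ M + ε_α`, area ratchet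
  `M' r₊(M',a') ≥ M r₊(M,a) − ε_β` and angular-momentum bookkeeping `|a'M' − aM| ≤ ε_γ`, with
  `ε_β ≤ (M²/16)√(1 − a²/M²)`, `ε_γ ≤ M²/16`, give `|M' − M| + |a' − a| ≤ 3ε_α + (8ε_γ + 6ε_β)/M`.
* small absorptions used by the line's composition (`abs_mul_le_sixteenth`,
  `abs_mul_le_sq_sixteenth`, `mul_le_quarter`, `le_sqrt_self_of_le_one`).

These are the kernel-checked non-stub lemmas of the registered skeleton
`Cruxes/NearExtremalKappaCapture/Lines/area-excess-ratchet.lean` (crux-plan, 2026-08-16), landed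
verbatim so that the skeleton imports them. Physics dictionary (Bardeen–Carter–Hawking first law,
Smarr): informal motivation only; nothing here depends on it.
-/

noncomputable section

-- single-conjunct summit: `Summit.FinalStateConjecture.FinalStateConjecture.…` is the mandated namespace (D-0017)
set_option linter.dupNamespace false

namespace Summit.FinalStateConjecture.FinalStateConjecture.Theorems.NearExtremalKappaCapture.AreaExcessRatchet

open Literature.Geometry.Lorentzian

/-! ## Real arithmetic of the ratchet -/

/-- `J'² ≥ J² − 2|J|ε` whenever `|J' − J| ≤ ε`. -/
theorem sq_sub_le_sq_of_abs_sub_le {J J' ε : ℝ} (h : |J' - J| ≤ ε) :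
    J ^ 2 - 2 * |J| * ε ≤ J' ^ 2 := by
  have hε : 0 ≤ ε := (abs_nonneg _).trans h
  have h1 : |J| - |J'| ≤ ε := by
    calc |J| - |J'| ≤ |J - J'| := abs_sub_abs_le_abs_sub J J'
      _ = |J' - J| := abs_sub_comm J J'
      _ ≤ ε := h
  have hJ2 : J ^ 2 = |J| ^ 2 := (sq_abs J).symm
  have hJ'2 : J' ^ 2 = |J'| ^ 2 := (sq_abs J').symm
  rcases le_or_gt |J| |J'| with hle | hlt
  · have h3 : |J| ^ 2 ≤ |J'| ^ 2 := pow_le_pow_left₀ (abs_nonneg J) hle 2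
    have h4 : 0 ≤ 2 * |J| * ε := by positivity
    rw [hJ2, hJ'2]
    linarith
  · have h2 : |J| ^ 2 - |J'| ^ 2 = (|J| - |J'|) * (|J| + |J'|) := by ring
    have h3 : (|J| - |J'|) * (|J| + |J'|) ≤ ε * (|J| + |J'|) :=
      mul_le_mul_of_nonneg_right h1 (by positivity)
    have h4 : ε * (|J| + |J'|) ≤ ε * (2 * |J|) :=
      mul_le_mul_of_nonneg_left (by linarith) hε
    have h5 : ε * (2 * |J|) = 2 * |J| * ε := by ring
    rw [hJ2, hJ'2]
    linarith

/-- Polynomial core of the first-law steepness estimate: from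
`(M S + y M − ε_β)² ≤ M² S² − y M³ + 2 M² ε_γ` with `y ≥ 0`, `ε_β ≤ M S`, `0 < M`, conclude
`y M² ≤ 2 M ε_γ + 2 S ε_β`. -/
theorem steep_core {M y S εβ εγ : ℝ} (hM : 0 < M) (hy : 0 ≤ y) (hSe : εβ ≤ M * S)
    (h : (M * S + y * M - εβ) ^ 2 ≤ M ^ 2 * S ^ 2 - y * M ^ 3 + 2 * M ^ 2 * εγ) :
    y * M ^ 2 ≤ 2 * M * εγ + 2 * S * εβ := by
  have hprod : 0 ≤ (y * M) * (M * S - εβ) := mul_nonneg (mul_nonneg hy hM.le) (by linarith)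
  have hexp : (M * S + y * M - εβ) ^ 2 =
      M ^ 2 * S ^ 2 + (y * M) ^ 2 + εβ ^ 2 + 2 * ((y * M) * (M * S - εβ)) - 2 * M * S * εβ := by
    ring
  have h1 : y * M ^ 3 ≤ 2 * M ^ 2 * εγ + 2 * M * S * εβ := by
    nlinarith [sq_nonneg (y * M), sq_nonneg εβ, hprod, hexp, h]
  have h2 : M * (y * M ^ 2) ≤ M * (2 * M * εγ + 2 * S * εβ) := by
    have e1 : M * (y * M ^ 2) = y * M ^ 3 := by ring
    have e2 : M * (2 * M * εγ + 2 * S * εβ) = 2 * M ^ 2 * εγ + 2 * M * S * εβ := by ring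
    rw [e1, e2]
    exact h1
  exact le_of_mul_le_mul_left h2 hM

/-- **First-law steepness (the ratchet's teeth).** If the final Kerr parameters `(M', a')` with
`0 < M' ≤ M`, `|a'| ≤ M'` have normalised horizon area `M' r₊(M', a') = A'/8π` at least
`M r₊(M, a) − ε_β` and angular momentum `|a'M' − aM| ≤ ε_γ`, then the mass can have DROPPED only by
`(M − M') M² ≤ 2 M ε_γ + 2 √(M² − a²) ε_β`: the area is steep in the mass at fixed angular momentum
near extremality (`∂(A/8π)/∂M |_J ≍ M/√(1 − a²/M²)`), so an area deficit `ε_β` of size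
`M² (1 − a²/M²)^{-1/2} · dist` costs only `O(M · dist)` in mass, UNIFORMLY in the surface gravity. -/
theorem mass_drop_le_of_budgets {M a M' a' εβ εγ : ℝ} (hM : 0 < M) (ha : |a| < M)
    (hM'0 : 0 < M') (hM'M : M' ≤ M) (ha' : |a'| ≤ M') (hεγ : 0 ≤ εγ)
    (hβ : M * Kerr.rPlus M a - εβ ≤ M' * Kerr.rPlus M' a')
    (hγ : |a' * M' - a * M| ≤ εγ) (hβs : εβ ≤ M * √(M ^ 2 - a ^ 2)) :
    (M - M') * M ^ 2 ≤ 2 * M * εγ + 2 * √(M ^ 2 - a ^ 2) * εβ := by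
  have hS0 : 0 ≤ √(M ^ 2 - a ^ 2) := Real.sqrt_nonneg _
  have haM0 : |a| * M ≤ M ^ 2 := by
    calc |a| * M ≤ M * M := mul_le_mul_of_nonneg_right ha.le hM.le
      _ = M ^ 2 := (sq M).symm
  have hMa : 0 ≤ M ^ 2 - a ^ 2 := by
    have : |a| ^ 2 ≤ M ^ 2 := pow_le_pow_left₀ (abs_nonneg a) ha.le 2
    rw [sq_abs] at this
    linarith
  have hSsq : √(M ^ 2 - a ^ 2) ^ 2 = M ^ 2 - a ^ 2 := Real.sq_sqrt hMa
  have hrp : Kerr.rPlus M a = M + √(M ^ 2 - a ^ 2) := rfl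
  have hrp' : Kerr.rPlus M' a' = M' + √(M' ^ 2 - a' ^ 2) := rfl
  have ha'sq : a' ^ 2 ≤ M' ^ 2 := by
    have : |a'| ^ 2 ≤ M' ^ 2 := pow_le_pow_left₀ (abs_nonneg a') ha' 2
    rwa [sq_abs] at this
  have hVsq : (M' * √(M' ^ 2 - a' ^ 2)) ^ 2 = M' ^ 2 * (M' ^ 2 - a' ^ 2) := by
    rw [mul_pow, Real.sq_sqrt (sub_nonneg.2 ha'sq)]
  -- the area hypothesis, unfolded
  have e1 : M * Kerr.rPlus M a = M ^ 2 + M * √(M ^ 2 - a ^ 2) := by rw [hrp]; ring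
  have e2 : M' * Kerr.rPlus M' a' = M' ^ 2 + M' * √(M' ^ 2 - a' ^ 2) := by rw [hrp']; ring
  rw [e1, e2] at hβ
  have hy0 : 0 ≤ M - M' := by linarith
  have h7 : (M - M') * M ≤ M ^ 2 - M' ^ 2 := by
    rw [show M ^ 2 - M' ^ 2 = (M - M') * M + (M - M') * M' by ring]
    linarith [mul_nonneg hy0 hM'0.le]
  have hyM0 : 0 ≤ (M - M') * M := mul_nonneg hy0 hM.le
  have hT0 : 0 ≤ M * √(M ^ 2 - a ^ 2) + (M - M') * M - εβ := by linarith
  have hTle : M * √(M ^ 2 - a ^ 2) + (M - M') * M - εβ ≤ M' * √(M' ^ 2 - a' ^ 2) := by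
    linarith
  have hTsq : (M * √(M ^ 2 - a ^ 2) + (M - M') * M - εβ) ^ 2 ≤ M' ^ 2 * (M' ^ 2 - a' ^ 2) := by
    rw [← hVsq]
    exact pow_le_pow_left₀ hT0 hTle 2
  -- angular momentum budget: (a'M')² ≥ (aM)² − 2M²εγ
  have hJ : (a * M) ^ 2 - 2 * M ^ 2 * εγ ≤ (a' * M') ^ 2 := by
    have h1 := sq_sub_le_sq_of_abs_sub_le hγ
    have h2 : |a * M| ≤ M ^ 2 := by rw [abs_mul, abs_of_pos hM]; exact haM0
    have h3 : 2 * |a * M| * εγ ≤ 2 * M ^ 2 * εγ :=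
      mul_le_mul_of_nonneg_right (by linarith) hεγ
    linarith
  -- M'⁴ ≤ M' M³
  have h4 : M' ^ 4 ≤ M' * M ^ 3 := by
    have h3 : M' ^ 3 ≤ M ^ 3 := pow_le_pow_left₀ hM'0.le hM'M 3
    calc M' ^ 4 = M' * M' ^ 3 := by ring
      _ ≤ M' * M ^ 3 := mul_le_mul_of_nonneg_left h3 hM'0.le
  -- combine into the hypothesis of `steep_core`
  have hstar : (M * √(M ^ 2 - a ^ 2) + (M - M') * M - εβ) ^ 2 ≤
      M ^ 2 * √(M ^ 2 - a ^ 2) ^ 2 - (M - M') * M ^ 3 + 2 * M ^ 2 * εγ := by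
    have haMsq : (a * M) ^ 2 = a ^ 2 * M ^ 2 := by ring
    have haM'sq : M' ^ 2 * (M' ^ 2 - a' ^ 2) = M' ^ 4 - (a' * M') ^ 2 := by ring
    have hR : M ^ 2 * √(M ^ 2 - a ^ 2) ^ 2 - (M - M') * M ^ 3 + 2 * M ^ 2 * εγ =
        M' * M ^ 3 - a ^ 2 * M ^ 2 + 2 * M ^ 2 * εγ := by
      rw [hSsq]; ring
    rw [hR]
    rw [haM'sq] at hTsq
    rw [haMsq] at hJ
    linarith
  exact steep_core hM hy0 hβs hstar

/-- **The laws pin the parameters (modulus from the budgets).** From the three budgets — mass loss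
`M' ≤ M + ε_α`, area ratchet `M' r₊(M',a') ≥ M r₊(M,a) − ε_β`, angular-momentum bookkeeping
`|a'M' − aM| ≤ ε_γ` — with `ε_β ≤ (M²/16)√(1 − a²/M²)` and `ε_γ ≤ M²/16`, the final parameters are
pinned: `|M' − M| + |a' − a| ≤ 3 ε_α + (8 ε_γ + 6 ε_β)/M`. In the skeleton `ε_α = C dist`,
`ε_β = C M² χ^{-q} dist`, `ε_γ = C χ^{-q} dist`, so the modulus exponent is `p = q` (and `p = 0` when
the area-deficit law has loss `χ^{-1/2}` and `J` is conserved — the card's axisymmetric prediction). -/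
theorem modulus_of_budgets :
    ∀ {M a M' a' εα εβ εγ : ℝ}, 0 < M → |a| < M → 0 < M' → |a'| ≤ M' → 0 ≤ εα → 0 ≤ εβ → 0 ≤ εγ →
      M' ≤ M + εα → M * Kerr.rPlus M a - εβ ≤ M' * Kerr.rPlus M' a' → |a' * M' - a * M| ≤ εγ →
        εβ ≤ M ^ 2 / 16 * √(1 - (a / M) ^ 2) → εγ ≤ M ^ 2 / 16 →
          |M' - M| + |a' - a| ≤ 3 * εα + (8 * εγ + 6 * εβ) / M := by
  intro M a M' a' εα εβ εγ hM ha hM'0 ha' hεα hεβ hεγ hα hβ hγ hβs hγs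
  have hS0 : 0 ≤ √(M ^ 2 - a ^ 2) := Real.sqrt_nonneg _
  have hSM : √(M ^ 2 - a ^ 2) ≤ M := by
    calc √(M ^ 2 - a ^ 2) ≤ √(M ^ 2) := Real.sqrt_le_sqrt (by nlinarith [sq_nonneg a])
      _ = M := Real.sqrt_sq hM.le
  have hsq : √(1 - (a / M) ^ 2) = √(M ^ 2 - a ^ 2) / M := Kerr.sqrt_one_sub_div_sq hM a
  have hsq1 : √(1 - (a / M) ^ 2) ≤ 1 := by
    rw [hsq, div_le_one hM]; exact hSM
  -- εβ ≤ M √(M² − a²) and εβ ≤ M²/16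
  have hβs1 : εβ ≤ M * √(M ^ 2 - a ^ 2) := by
    have e : M ^ 2 / 16 * √(1 - (a / M) ^ 2) = M * √(M ^ 2 - a ^ 2) / 16 := by
      rw [hsq]; field_simp
    rw [e] at hβs
    have : 0 ≤ M * √(M ^ 2 - a ^ 2) := mul_nonneg hM.le hS0
    linarith
  have hβs2 : εβ ≤ M ^ 2 / 16 :=
    hβs.trans (mul_le_of_le_one_right (by positivity) hsq1)
  -- lower mass bound
  have hlow : (M - M') * M ^ 2 ≤ 2 * M * εγ + 2 * √(M ^ 2 - a ^ 2) * εβ := by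
    rcases le_or_gt M' M with hle | hlt
    · exact mass_drop_le_of_budgets hM ha hM'0 hle ha' hεγ hβ hγ hβs1
    · have h1 : (M - M') * M ^ 2 ≤ 0 :=
        mul_nonpos_of_nonpos_of_nonneg (by linarith) (sq_nonneg M)
      have h2 : 0 ≤ 2 * M * εγ := by positivity
      have h3 : 0 ≤ 2 * √(M ^ 2 - a ^ 2) * εβ := by positivity
      linarith
  have hlow' : M - M' ≤ (2 * εγ + 2 * εβ) / M := by
    rw [le_div_iff₀ hM]
    have h1 : 2 * √(M ^ 2 - a ^ 2) * εβ ≤ 2 * M * εβ := by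
      have := mul_le_mul_of_nonneg_right hSM hεβ
      linarith
    have h2 : M * ((M - M') * M) ≤ M * (2 * εγ + 2 * εβ) := by
      have e1 : M * ((M - M') * M) = (M - M') * M ^ 2 := by ring
      have e2 : M * (2 * εγ + 2 * εβ) = 2 * M * εγ + 2 * M * εβ := by ring
      rw [e1, e2]
      linarith
    exact le_of_mul_le_mul_left h2 hM
  have hdiv0 : 0 ≤ (2 * εγ + 2 * εβ) / M := by positivity
  have habsM : |M' - M| ≤ εα + (2 * εγ + 2 * εβ) / M := by
    rw [abs_le]
    constructor
    · linarith
    · linarith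
  -- M' ≥ M/2
  have hquarter : (2 * εγ + 2 * εβ) / M ≤ M / 4 := by
    rw [div_le_iff₀ hM]
    have : M / 4 * M = M ^ 2 / 4 := by ring
    rw [this]
    linarith
  have hM'half : M / 2 ≤ M' := by linarith
  -- spin
  have hspin : |a' - a| * M' ≤ εγ + M * |M' - M| := by
    have hid : (a' - a) * M' = (a' * M' - a * M) - a * (M' - M) := by ring
    have h1 : |a| * |M' - M| ≤ M * |M' - M| := mul_le_mul_of_nonneg_right ha.le (abs_nonneg _)
    calc |a' - a| * M' = |(a' - a) * M'| := by rw [abs_mul, abs_of_pos hM'0]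
      _ = |(a' * M' - a * M) - a * (M' - M)| := by rw [hid]
      _ ≤ |a' * M' - a * M| + |a * (M' - M)| := abs_sub _ _
      _ = |a' * M' - a * M| + |a| * |M' - M| := by rw [abs_mul]
      _ ≤ εγ + M * |M' - M| := by linarith
  have hspin2 : |a' - a| * M ≤ 2 * εγ + 2 * M * |M' - M| := by
    have h1 : |a' - a| * (M / 2) ≤ |a' - a| * M' :=
      mul_le_mul_of_nonneg_left hM'half (abs_nonneg (a' - a))
    calc |a' - a| * M = 2 * (|a' - a| * (M / 2)) := by ring
      _ ≤ 2 * (|a' - a| * M') := by linarith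
      _ ≤ 2 * (εγ + M * |M' - M|) := by linarith
      _ = 2 * εγ + 2 * M * |M' - M| := by ring
  have hspin' : |a' - a| ≤ 2 * εγ / M + 2 * |M' - M| := by
    have h3 : |a' - a| ≤ (2 * εγ + 2 * M * |M' - M|) / M := by
      rw [le_div_iff₀ hM]; exact hspin2
    calc |a' - a| ≤ (2 * εγ + 2 * M * |M' - M|) / M := h3
      _ = 2 * εγ / M + 2 * |M' - M| := by field_simp
  calc |M' - M| + |a' - a| ≤ 3 * |M' - M| + 2 * εγ / M := by
        linarith [abs_nonneg (M' - M)]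
    _ ≤ 3 * (εα + (2 * εγ + 2 * εβ) / M) + 2 * εγ / M := by linarith
    _ = 3 * εα + (8 * εγ + 6 * εβ) / M := by
        field_simp
        ring

/-! ## Small absorptions used by the composition of the line -/

/-- `|C| c ≤ 1/16` once `c ≤ 1/(16(|C|+1))`. -/
theorem abs_mul_le_sixteenth {C c : ℝ} (hc : c ≤ 1 / (16 * (|C| + 1))) : |C| * c ≤ 1 / 16 := by
  calc |C| * c ≤ |C| * (1 / (16 * (|C| + 1))) := mul_le_mul_of_nonneg_left hc (abs_nonneg _)
    _ ≤ 1 / 16 := by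
        rw [mul_one_div, div_le_div_iff₀ (by positivity) (by positivity)]
        nlinarith [abs_nonneg C]

/-- `|C| c ≤ M²/16` once `c ≤ M²/(16(|C|+1))`. -/
theorem abs_mul_le_sq_sixteenth {C c M : ℝ} (hc : c ≤ M ^ 2 / (16 * (|C| + 1))) :
    |C| * c ≤ M ^ 2 / 16 := by
  calc |C| * c ≤ |C| * (M ^ 2 / (16 * (|C| + 1))) := mul_le_mul_of_nonneg_left hc (abs_nonneg _)
    _ ≤ M ^ 2 / 16 := by
        rw [mul_div_assoc', div_le_div_iff₀ (by positivity) (by positivity)]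
        have e : M ^ 2 * (16 * (|C| + 1)) - |C| * M ^ 2 * 16 = 16 * M ^ 2 := by ring
        nlinarith [sq_nonneg M, e, abs_nonneg C]

/-- `K c ≤ M/4` once `0 ≤ K`, `0 < M`, `c ≤ M/(4(K+1))`. -/
theorem mul_le_quarter {K c M : ℝ} (hK : 0 ≤ K) (hM : 0 < M) (hc : c ≤ M / (4 * (K + 1))) :
    K * c ≤ M / 4 := by
  calc K * c ≤ K * (M / (4 * (K + 1))) := mul_le_mul_of_nonneg_left hc hK
    _ ≤ M / 4 := by
        rw [mul_div_assoc', div_le_div_iff₀ (by positivity) (by positivity)]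
        have e : M * (4 * (K + 1)) - K * M * 4 = 4 * M := by ring
        nlinarith [e, hM.le]

/-- `x ≤ √x` on `[0, 1]`. -/
theorem le_sqrt_self_of_le_one {x : ℝ} (h0 : 0 ≤ x) (h1 : x ≤ 1) : x ≤ √x := by
  have hs1 : √x ≤ 1 := by
    calc √x ≤ √1 := Real.sqrt_le_sqrt h1
      _ = 1 := Real.sqrt_one
  calc x = √x * √x := (Real.mul_self_sqrt h0).symm
    _ ≤ √x * 1 := mul_le_mul_of_nonneg_left hs1 (Real.sqrt_nonneg _)
    _ = √x := mul_one _

end Summit.FinalStateConjecture.FinalStateConjecture.Theorems.NearExtremalKappaCapture.AreaExcessRatchet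

end
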